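import Mathlib
import Summits.Ventures.PercRepro2.Defs
import Summits.Ventures.PercRepro2.Graph
import Summits.Ventures.PercRepro2.Harris
import Summits.Ventures.PercRepro2.XWForm
import Summits.Ventures.PercRepro2.XWEdgeSY

/-!
# The sharpened `s–y` concavity defect: the four-cell form (PercRepro2, p2 g26)

Under `Q = {s ↮ y}` the union events `U = {s ↔ u} ∪ {y ↔ u}`, `O = {y ↔ o} ∪ {s ↔ o}` of
`XWEdgeSY.lean` split into disjoint halves (`u`, resp. `o`, lies in the cluster of `s` or in the
cluster of `y`, never in both), so `Q ∩ U ∩ O` is the disjoint union of the four cells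
`Q ∩ a ∩ h`, `Q ∩ a ∩ λ`, `Q ∩ b ∩ h`, `Q ∩ b ∩ λ` with `a = {s ↔ u}`, `b = {y ↔ u}`, `h = {s ↔ o}`,
`λ = {y ↔ o}` (`prob_Q_inter_U_inter_O`).  Dropping the cell `Q ∩ b ∩ h` (`u ∈ C_y`, `o ∈ C_s`)
from the positive side of `dSY` gives the **sharpened defect**

  `csySharp = P(Q)·[P(Qah) + P(Qaλ) + P(Qbλ)] − P(Qa)·P(Q ∩ O) − P(Qb)·P(Qλ)`

(in covariance language: `Cov_Q(u ∈ C_s, o ∈ C_s) + Cov_Q(u ∈ C_s, o ∈ C_y) + Cov_Q(u ∈ C_y, o ∈ C_y)`,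
i.e. `Cov_Q(U, O) ≥ Cov_Q(u ∈ C_y, o ∈ C_s)`), and the exact relation

  `dSY = csySharp + P(Q)·P(Q ∩ b ∩ h)`          (`dSY_eq_csySharp_add`),

so `0 ≤ csySharp` — the conjecture (C-sy″) of this seat, census-true (0 / ≈ 4,600 instances, own
code, extreme palette) — implies the edge-removal conjecture `0 ≤ dSY` (`dSY_nonneg_of_csySharp`)
and hence the `s–y` edge-removal reduction of (XW) (`xwBil_nonneg_of_csySharp_nonneg`).  The
K-explained refinement of (C-sy″) (the `C_y`-term replaced by the covariance of the conditional
probabilities given `C_s`) is FALSE (witness in the record P2-G26-CSY.md), so `csySharp` is the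
sharpest member of this family that survives.  Own work; standard axioms.
-/

namespace Summit.Ventures.PercRepro2

namespace XWEdgeSY

variable {V : Type*} {E : Type*} [Fintype E] [DecidableEq E] {R : Type*} [CommRing R]

variable (ends : E → Sym2 V) (s y o u : V)

/-- **The sharpened defect** `csySharp = P(Q)·[P(Q ∩ a ∩ h) + P(Q ∩ a ∩ λ) + P(Q ∩ b ∩ λ)]
− P(Q ∩ a)·P(Q ∩ O) − P(Q ∩ b)·P(Q ∩ λ)` with `a = {s ↔ u}`, `b = {y ↔ u}`, `h = {s ↔ o}`,
`λ = {y ↔ o}`, `Q = {s ↮ y}`. -/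
noncomputable def csySharp (p : E → R) : R :=
  prob p (connEvent ends s y)ᶜ *
      (prob p ((connEvent ends s y)ᶜ ∩ (connEvent ends s u ∩ connEvent ends s o)) +
        prob p ((connEvent ends s y)ᶜ ∩ (connEvent ends s u ∩ connEvent ends y o)) +
        prob p ((connEvent ends s y)ᶜ ∩ (connEvent ends y u ∩ connEvent ends y o))) -
    prob p ((connEvent ends s y)ᶜ ∩ connEvent ends s u) *
      prob p ((connEvent ends s y)ᶜ ∩ O ends s y o) -
    prob p ((connEvent ends s y)ᶜ ∩ connEvent ends y u) *
      prob p ((connEvent ends s y)ᶜ ∩ connEvent ends y o)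

variable {ends s y}

omit [Fintype E] [DecidableEq E] in
/-- On `Q`, `U ∩ O` is the disjoint union of the four cells. -/
lemma Q_inter_U_inter_O_eq :
    (connEvent ends s y)ᶜ ∩ (U ends s y u ∩ O ends s y o) =
      ((connEvent ends s y)ᶜ ∩ (connEvent ends s u ∩ connEvent ends s o) ∪
          (connEvent ends s y)ᶜ ∩ (connEvent ends s u ∩ connEvent ends y o)) ∪
        ((connEvent ends s y)ᶜ ∩ (connEvent ends y u ∩ connEvent ends s o) ∪
          (connEvent ends s y)ᶜ ∩ (connEvent ends y u ∩ connEvent ends y o)) := by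
  ext ω
  simp only [U, O, Set.mem_inter_iff, Set.mem_union, Set.mem_compl_iff, mem_connEvent]
  tauto

omit [Fintype E] [DecidableEq E] in
/-- Two cells with different `u`-sides are disjoint on `Q`. -/
lemma disjoint_Q_cells_u {A B : Set (Config E)} :
    Disjoint ((connEvent ends s y)ᶜ ∩ (connEvent ends s u ∩ A))
      ((connEvent ends s y)ᶜ ∩ (connEvent ends y u ∩ B)) := by
  rw [Set.disjoint_left]
  rintro ω ⟨hQ, hsu, _⟩ ⟨_, hyu, _⟩
  exact hQ (conn_trans hsu (conn_symm hyu))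

omit [Fintype E] [DecidableEq E] in
/-- Two cells with different `o`-sides are disjoint on `Q`. -/
lemma disjoint_Q_cells_o {A B : Set (Config E)} :
    Disjoint ((connEvent ends s y)ᶜ ∩ (A ∩ connEvent ends s o))
      ((connEvent ends s y)ᶜ ∩ (B ∩ connEvent ends y o)) := by
  rw [Set.disjoint_left]
  rintro ω ⟨hQ, _, hso⟩ ⟨_, _, hyo⟩
  exact hQ (conn_trans hso (conn_symm hyo))

/-- `P(Q ∩ U ∩ O)` is the sum of the four cells. -/
lemma prob_Q_inter_U_inter_O (p : E → R) :
    prob p ((connEvent ends s y)ᶜ ∩ (U ends s y u ∩ O ends s y o)) =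
      prob p ((connEvent ends s y)ᶜ ∩ (connEvent ends s u ∩ connEvent ends s o)) +
        prob p ((connEvent ends s y)ᶜ ∩ (connEvent ends s u ∩ connEvent ends y o)) +
        (prob p ((connEvent ends s y)ᶜ ∩ (connEvent ends y u ∩ connEvent ends s o)) +
          prob p ((connEvent ends s y)ᶜ ∩ (connEvent ends y u ∩ connEvent ends y o))) := by
  rw [Q_inter_U_inter_O_eq (o := o) (u := u), prob_union_of_disjoint, prob_union_of_disjoint,
    prob_union_of_disjoint]
  · exact disjoint_Q_cells_o o
  · exact disjoint_Q_cells_o o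
  · rw [Set.disjoint_union_left, Set.disjoint_union_right, Set.disjoint_union_right]
    exact ⟨⟨disjoint_Q_cells_u u, disjoint_Q_cells_u u⟩, ⟨disjoint_Q_cells_u u, disjoint_Q_cells_u u⟩⟩

/-- `P(Q ∩ U) = P(Q ∩ a) + P(Q ∩ b)`. -/
lemma prob_Q_inter_U (p : E → R) :
    prob p ((connEvent ends s y)ᶜ ∩ U ends s y u) =
      prob p ((connEvent ends s y)ᶜ ∩ connEvent ends s u) +
        prob p ((connEvent ends s y)ᶜ ∩ connEvent ends y u) := by
  have e : (connEvent ends s y)ᶜ ∩ U ends s y u =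
      (connEvent ends s y)ᶜ ∩ connEvent ends s u ∪
        (connEvent ends s y)ᶜ ∩ connEvent ends y u := by
    simp only [U, Set.inter_union_distrib_left]
  have d : Disjoint ((connEvent ends s y)ᶜ ∩ connEvent ends s u)
      ((connEvent ends s y)ᶜ ∩ connEvent ends y u) := by
    rw [Set.disjoint_left]
    rintro ω ⟨hQ, hsu⟩ ⟨_, hyu⟩
    exact hQ (conn_trans hsu (conn_symm hyu))
  rw [e, prob_union_of_disjoint p d]

variable (ends s y) in
/-- **The exact relation** `dSY = csySharp + P(Q)·P(Q ∩ b ∩ h)`: the defect exceeds the sharpened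
defect by the cell `u ∈ C_y`, `o ∈ C_s` weighted by `P(Q)`. -/
theorem dSY_eq_csySharp_add (p : E → R) :
    dSY ends s y o u p =
      csySharp ends s y o u p +
        prob p (connEvent ends s y)ᶜ *
          prob p ((connEvent ends s y)ᶜ ∩ (connEvent ends y u ∩ connEvent ends s o)) := by
  unfold dSY csySharp
  rw [prob_Q_inter_U_inter_O, prob_Q_inter_U]
  have hO : prob p ((connEvent ends s y)ᶜ ∩ O ends s y o) =
      prob p ((connEvent ends s y)ᶜ ∩ connEvent ends y o) +
        prob p ((connEvent ends s y)ᶜ ∩ connEvent ends s o) := by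
    rw [Q_inter_O_eq, prob_union_of_disjoint p (Q_inter_O_disjoint o)]
  rw [hO]
  ring

variable (ends s y) in
/-- `0 ≤ csySharp → 0 ≤ dSY` ((C-sy″) implies (C-sy)). -/
theorem dSY_nonneg_of_csySharp [LinearOrder R] [IsStrictOrderedRing R] {p : E → R}
    (hp : IsProbVec p) (h : 0 ≤ csySharp ends s y o u p) : 0 ≤ dSY ends s y o u p := by
  rw [dSY_eq_csySharp_add]
  have h1 := prob_nonneg hp (connEvent ends s y)ᶜ
  have h2 := prob_nonneg hp ((connEvent ends s y)ᶜ ∩ (connEvent ends y u ∩ connEvent ends s o))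
  positivity

variable (ends s y) in
/-- **The `s–y` edge-removal reduction from the sharpened conjecture**: if `0 ≤ csySharp` with `e`
closed and (XW) holds with `e` closed, then (XW) holds at `p`. -/
theorem xwBil_nonneg_of_csySharp_nonneg [LinearOrder R] [IsStrictOrderedRing R] {p : E → R}
    (hp : IsProbVec p) {e : E} (he : ends e = s(s, y))
    (hC : 0 ≤ csySharp ends s y o u (Function.update p e 0))
    (h0 : 0 ≤ xwBil ends s y o u (Function.update p e 0) (Function.update p e 0)) :
    0 ≤ xwBil ends s y o u p p :=
  xwBil_nonneg_of_dSY_nonneg ends s y o u hp he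
    (dSY_nonneg_of_csySharp ends s y o u (hp.update e (le_refl 0) zero_le_one) hC) h0

end XWEdgeSY

end Summit.Ventures.PercRepro2
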